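import Literature.MathematicalPhysics.KineticTheory.LangevinChainHarris
import HarnessLib

/-!
# CEHR Theorem 3.1 (2)–(3) for an arbitrary Markov semigroup of an oscillator chain: Krylov–Bogoliubov and Harris from H2, (3.4) and a minorisation

Topic `Literature/MathematicalPhysics/KineticTheory` (trunk T-KINETIC). Third proof file of the
provefact unit for `CuneoEckmannHairerReyBellet2018_thm213_pureQuartic` (`PureQuarticChainNESS.lean`);
MODEL-FREE. Cuneo–Eckmann–Hairer–Rey-Bellet, EJP **23** (2018) no. 55, §3.3: Proposition 3.7
("Under H2, the process admits an invariant measure `μ⋆`, and `V` is integrable with respect to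
`μ⋆`", Krylov–Bogoliubov with (3.4)–(3.6)) and Proposition 3.8 ("Under Conditions H1 and H2, the
exponential convergence (2.5) holds", Harris' theorem of Hairer–Mattingly 2011 on the skeleton
`(P^{nt₀})` with `C = {V ≤ R}`, `t₀ ≥ t_C` from Prop. 3.6, then `t = nt₀ + r` with (3.4)).

`LangevinChainHarris.lean` proved exactly this for ONE semigroup (`pinnedChainSemigroup`, the
older pipeline). The proofs use nothing about the pinned chain beyond: the interface
`LangevinChainSemigroup P N T_L T_R`, the Feller property, the a-priori bound (3.4)
`∫ e^{θH} dP_t(z,·) ≤ e^{C t} e^{θH(z)}`, continuity and nonnegativity of `H`, compact sublevel sets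
`{e^{θH} ≤ R}`, the Lyapunov condition H2 for the kernels of `S` and the minorisation of Prop. 3.6
for the kernels of `S`. This file records them in that generality (same proofs, hypotheses made
explicit; no definition, no named fact), for use by the purely quartic chain on the model-free
pipeline (and any other confining chain):

* `LangevinChainSemigroup.exists_isInvariant_of_H2` — **Prop. 3.7 / Thm 2.13 (2)**: an invariant
  probability measure integrating `e^{ϑH}` for every `0 < ϑ < 1/max(T_L,T_R)`;
* `LangevinChainSemigroup.harris_of_H2_of_minorization` — Assumptions 1–2 of Hairer–Mattingly for
  the skeleton `P_m` and their consequences (uniqueness for `P_m`, finite `e^{ϑH}`-moments,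
  geometric convergence);
* `LangevinChainSemigroup.exp_convergence_of_H2_of_minorization` — **Prop. 3.8 / Thm 2.13 (3)**:
  the exponential convergence (2.5) in the `e^{ϑH}`-weighted norm, for every invariant probability
  measure;
* `LangevinChainSemigroup.invariant_unique_of_H2_of_minorization` — **Thm 2.13 (1), uniqueness**.

## References

* N. Cuneo, J.-P. Eckmann, M. Hairer, L. Rey-Bellet, EJP **23** (2018) no. 55 (arXiv:1712.09413):
  Thm 2.13, §3 (3.4)–(3.6), Props. 3.6, 3.7, 3.8 (proof). Page numbers refer to the arXiv version.
* M. Hairer, J. C. Mattingly, *Yet another look at Harris' ergodic theorem for Markov chains*,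
  Progr. Probab. **63** (2011) 109–117, Thms 1.2, 1.3, 3.1.
-/

noncomputable section

open MeasureTheory ProbabilityTheory Filter Topology Set
open scoped NNReal ENNReal BoundedContinuousFunction

namespace Literature.MathematicalPhysics.KineticTheory.HeatConduction

open Literature.Probability.Process OscillatorChain

variable {N : ℕ}

namespace LangevinChainSemigroup

variable {P : OscillatorChain} {T_L T_R : ℝ} (S : LangevinChainSemigroup P N T_L T_R)
  (hF : ∀ (t : ℝ≥0) (g : PhaseSpace N →ᵇ ℝ), Continuous (S.act t g))
  (hHc : Continuous (P.hamiltonian N))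
  (hcpt : ∀ θ : ℝ, 0 < θ → ∀ R : ℝ≥0,
    IsCompact {x : PhaseSpace N | (Real.exp (θ * P.hamiltonian N x)).toNNReal ≤ R})
  {Cstar : ℝ → ℝ} (hCstar : ∀ θ, 0 < θ → 0 ≤ Cstar θ)
  (h34 : ∀ θ : ℝ, 0 < θ → θ < 1 / max T_L T_R → ∀ (t : ℝ≥0) (z : PhaseSpace N),
    ∫⁻ y, ENNReal.ofReal (Real.exp (θ * P.hamiltonian N y)) ∂(S.kernel t z) ≤
      ENNReal.ofReal (Real.exp (Cstar θ * t) * Real.exp (θ * P.hamiltonian N z)))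
  (h2 : ∀ θ : ℝ, 0 < θ → θ < 1 / max T_L T_R → ∀ tstar : ℝ≥0, 0 < tstar →
    ∃ (κ c : ℝ) (K : Set (PhaseSpace N)), 0 < κ ∧ κ < 1 ∧ 0 < c ∧ IsCompact K ∧
      ∀ z : PhaseSpace N,
        ∫⁻ y, ENNReal.ofReal (Real.exp (θ * P.hamiltonian N y)) ∂(S.kernel tstar z) ≤
          ENNReal.ofReal (κ * Real.exp (θ * P.hamiltonian N z) + c * K.indicator 1 z))
  (hTm : 0 < 1 / max T_L T_R)

/-! ### Theorem 2.13 (2) for the semigroup (Krylov–Bogoliubov, Prop. 3.7) -/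

include hF hHc hcpt hCstar h34 h2 hTm in
/-- **CEHR Prop. 3.7 / Theorem 2.13 (2) for a Feller Markov semigroup of the chain satisfying (3.4)
and H2**: there is an invariant probability measure under which `e^{ϑH}` is integrable for every
`0 < ϑ < 1/max(T_L, T_R)` (the Krylov–Bogoliubov theorem of `KrylovBogoliubov.lean` applied to the
whole family of Lyapunov functions `e^{ϑH}`, whose orbit integrals are bounded by H2 at `t* = 1`
and (3.4) on `[0, 1)`; compact sublevel sets of one of them give tightness).
[cite: CuneoEckmannHairerReyBellet2018, Thm 2.13 (2) and Prop 3.7] -/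
theorem exists_isInvariant_of_H2 :
    ∃ μ : Measure (PhaseSpace N), IsProbabilityMeasure μ ∧ S.IsInvariant μ ∧
      ∀ ϑ : ℝ, 0 < ϑ → ϑ < 1 / max T_L T_R →
        Integrable (fun z => Real.exp (ϑ * P.hamiltonian N z)) μ := by
  -- the family of Lyapunov functions `e^{ϑH}`, `0 < ϑ < 1/T_max`
  let ι := {ϑ : ℝ // 0 < ϑ ∧ ϑ < 1 / max T_L T_R}
  let V : ι → PhaseSpace N → ℝ≥0 := fun ϑ x => (Real.exp (ϑ.1 * P.hamiltonian N x)).toNNReal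
  have hVapply : ∀ (ϑ : ι) (x : PhaseSpace N),
      (V ϑ x : ℝ≥0∞) = ENNReal.ofReal (Real.exp (ϑ.1 * P.hamiltonian N x)) := fun ϑ x => rfl
  have hV : ∀ ϑ : ι, Continuous (V ϑ) := fun ϑ =>
    continuous_real_toNNReal.comp (Real.continuous_exp.comp (continuous_const.mul hHc))
  -- H2 at `t* = 1` and (3.4) on `[0,1)`, in the form consumed by the abstract theorem
  have hlyap : ∀ ϑ : ι, ∃ (tstar : ℝ≥0) (a b c : ℝ≥0∞), 0 < tstar ∧ a < 1 ∧ b ≠ ⊤ ∧ c ≠ ⊤ ∧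
      (∀ x, ∫⁻ y, V ϑ y ∂(S.kernel tstar x) ≤ a * V ϑ x + b) ∧
      (∀ r : ℝ≥0, r < tstar → ∀ x, ∫⁻ y, V ϑ y ∂(S.kernel r x) ≤ c * V ϑ x) := by
    intro ϑ
    obtain ⟨a, c, K, ha0, ha1, hc, -, hbound⟩ := h2 ϑ.1 ϑ.2.1 ϑ.2.2 1 one_pos
    refine ⟨1, ENNReal.ofReal a, ENNReal.ofReal c, ENNReal.ofReal (Real.exp (Cstar ϑ.1)), one_pos,
      ENNReal.ofReal_lt_one.2 ha1, ENNReal.ofReal_ne_top, ENNReal.ofReal_ne_top,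
      fun x => ?_, fun r hr x => ?_⟩
    · refine (hbound x).trans ?_
      rw [hVapply, ← ENNReal.ofReal_mul ha0.le,
        ← ENNReal.ofReal_add (by positivity) (by positivity)]
      refine ENNReal.ofReal_le_ofReal (add_le_add le_rfl ?_)
      calc c * K.indicator 1 x ≤ c * 1 := by
            refine mul_le_mul_of_nonneg_left ?_ hc.le
            exact Set.indicator_le_self' (fun _ _ => zero_le_one) x
        _ = c := mul_one c
    · refine (h34 ϑ.1 ϑ.2.1 ϑ.2.2 r x).trans ?_
      rw [hVapply, ← ENNReal.ofReal_mul (by positivity)]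
      refine ENNReal.ofReal_le_ofReal (mul_le_mul_of_nonneg_right ?_ (by positivity))
      refine Real.exp_le_exp.2 ?_
      have hr' : ((r : ℝ≥0) : ℝ) ≤ 1 := by exact_mod_cast hr.le
      have h0 : 0 ≤ Cstar ϑ.1 := hCstar ϑ.1 ϑ.2.1
      nlinarith
  -- a distinguished index with compact sublevel sets
  let ϑ₀ : ι := ⟨1 / max T_L T_R / 2, by positivity, half_lt_self hTm⟩
  have hcpt₀ : ∀ R : ℝ≥0, IsCompact {x | V ϑ₀ x ≤ R} := fun R => hcpt ϑ₀.1 ϑ₀.2.1 R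
  obtain ⟨μ, hμ, hinv, hfin⟩ := MarkovSemigroup.exists_invariant_of_lyapunov S.kernel
    S.kernel_zero S.kernel_add S.measurable_kernel hF V hV hlyap ϑ₀ hcpt₀ 0
  refine ⟨μ, hμ, hinv, fun ϑ h0 h1 => ?_⟩
  refine ⟨(Real.continuous_exp.comp (continuous_const.mul hHc)).aestronglyMeasurable, ?_⟩
  have hlt := hfin ⟨ϑ, h0, h1⟩
  simp only [hVapply] at hlt
  show ∫⁻ x, ‖Real.exp (ϑ * P.hamiltonian N x)‖ₑ ∂μ < ⊤
  simpa only [Real.enorm_eq_ofReal (Real.exp_nonneg _)] using hlt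

/-! ### Harris' theorem for the skeleton chain `P_m`, `m ∈ ℕ` large -/

include hHc hcpt h2 in
/-- **Assumptions 1–2 of Hairer–Mattingly for the skeleton chain of `S`, and their consequences**
(CEHR proof of Prop. 3.8): for `0 < ϑ < 1/max(T_L,T_R)` and `V = e^{ϑH}`, H2 at `t* = 1` gives
`P_1 V ≤ κV + c`, hence `P_m V ≤ κᵐ V + c/(1-κ)` (CEHR (3.5)); with `R = (2c/(1-κ) + 1)/(1-κ)`
the sublevel set `{V ≤ R}` is compact, the minorisation hypothesis (Prop. 3.6 for the kernels of
`S`) provides `t_C`, and for `m = max(1, ⌈t_C⌉)` Harris' theorem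
(`Literature.Probability.Process.Harris.harris`) applies to `P_m`: at most one invariant
probability measure, finite `V`-moments and geometric convergence in the `V`-norm.
[cite: CuneoEckmannHairerReyBellet2018, Prop 3.8 (proof)] -/
theorem harris_of_H2_of_minorization
    (h36 : ∀ C : Set (PhaseSpace N), IsCompact C → ∃ t_C : ℝ≥0, ∀ t : ℝ≥0, t_C ≤ t →
      ∃ ν : Measure (PhaseSpace N), ν ≠ 0 ∧ ∀ z ∈ C, ν ≤ S.kernel t z)
    {ϑ : ℝ} (hϑ0 : 0 < ϑ) (hϑ1 : ϑ < 1 / max T_L T_R) :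
    ∃ (m : ℕ) (abar b : ℝ), 0 < m ∧ 0 < abar ∧ abar < 1 ∧ 0 < b ∧
      (∀ μ₁ μ₂ : Measure (PhaseSpace N), IsProbabilityMeasure μ₁ → IsProbabilityMeasure μ₂ →
        Kernel.Invariant (S.kernel m) μ₁ → Kernel.Invariant (S.kernel m) μ₂ → μ₁ = μ₂) ∧
      (∀ μ : Measure (PhaseSpace N), IsProbabilityMeasure μ → Kernel.Invariant (S.kernel m) μ →
        ∫⁻ z, ENNReal.ofReal (Real.exp (ϑ * P.hamiltonian N z)) ∂μ ≠ ∞ ∧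
        ∀ (n : ℕ) (φ : PhaseSpace N → ℝ), Measurable φ →
          (∀ x, |φ x| ≤ 1 + b * Real.exp (ϑ * P.hamiltonian N x)) →
          ∀ x, |∫ z, φ z ∂((S.kernel m ^ n) x) - ∫ z, φ z ∂μ| ≤
            abar ^ n * (2 + b * Real.exp (ϑ * P.hamiltonian N x) +
              b * (∫⁻ z, ENNReal.ofReal (Real.exp (ϑ * P.hamiltonian N z)) ∂μ).toReal)) := by
  set Hm := P.hamiltonian N with hHm
  -- the Lyapunov function `V = e^{ϑH}` as an `ℝ≥0`-valued function
  set V : PhaseSpace N → ℝ≥0 := fun z => (Real.exp (ϑ * Hm z)).toNNReal with hVdef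
  have hVc : Continuous V := continuous_real_toNNReal.comp (Real.continuous_exp.comp
    (continuous_const.mul hHc))
  have hV : Measurable V := hVc.measurable
  have hVcoe : ∀ z, (V z : ℝ≥0∞) = ENNReal.ofReal (Real.exp (ϑ * Hm z)) := fun z => rfl
  have hVreal : ∀ z, (V z : ℝ) = Real.exp (ϑ * Hm z) := fun z =>
    Real.coe_toNNReal _ (Real.exp_pos _).le
  -- H2 at `t* = 1`: the drift condition for `P₁`
  obtain ⟨κ₀, c, K, hκ₀, hκ₁, hc, -, hbound⟩ := h2 ϑ hϑ0 hϑ1 1 one_pos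
  set a : ℝ≥0 := κ₀.toNNReal with ha
  set b₀ : ℝ≥0 := c.toNNReal with hb₀
  have ha1 : a < 1 := by
    rw [← NNReal.coe_lt_coe, ha, Real.coe_toNNReal _ hκ₀.le, NNReal.coe_one]; exact hκ₁
  have hdrift1 : ∀ z, ∫⁻ y, V y ∂(S.kernel 1 z) ≤ (a : ℝ≥0∞) * V z + b₀ := by
    intro z
    refine (hbound z).trans ?_
    calc ENNReal.ofReal (κ₀ * Real.exp (ϑ * Hm z) + c * K.indicator 1 z)
        ≤ ENNReal.ofReal (κ₀ * Real.exp (ϑ * Hm z)) + ENNReal.ofReal (c * K.indicator 1 z) :=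
          ENNReal.ofReal_add_le
      _ ≤ ENNReal.ofReal (κ₀ * Real.exp (ϑ * Hm z)) + ENNReal.ofReal c := by
          refine add_le_add le_rfl (ENNReal.ofReal_le_ofReal ?_)
          calc c * K.indicator 1 z ≤ c * 1 := by
                refine mul_le_mul_of_nonneg_left ?_ hc.le
                exact Set.indicator_le_self' (fun _ _ => zero_le_one) z
            _ = c := mul_one c
      _ = ENNReal.ofReal κ₀ * ENNReal.ofReal (Real.exp (ϑ * Hm z)) + ENNReal.ofReal c := by
          rw [ENNReal.ofReal_mul hκ₀.le]
      _ = (a : ℝ≥0∞) * V z + b₀ := rfl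
  -- the skeleton at an integer time `m ≥ 1`: drift with `γ = aᵐ`, `K = b₀/(1-a)`
  set B : ℝ≥0 := b₀ / (1 - a) with hB
  have h1a : 0 < 1 - a := tsub_pos_of_lt ha1
  set R : ℝ≥0 := (2 * B + 1) / (1 - a) with hRdef
  have hRa : (1 - a) * R = 2 * B + 1 := by
    rw [hRdef, mul_comm, div_mul_cancel₀ _ h1a.ne']
  -- the compact sublevel set `{V ≤ R}` and Prop. 3.6
  have hcptR : IsCompact {z : PhaseSpace N | V z ≤ R} := hcpt ϑ hϑ0 R
  obtain ⟨t_C, ht_C⟩ := h36 _ hcptR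
  set m : ℕ := max 1 ⌈t_C⌉₊ with hm
  have hm1 : 1 ≤ m := le_max_left _ _
  have hm0 : m ≠ 0 := by omega
  have hmt : t_C ≤ (m : ℝ≥0) := (Nat.le_ceil t_C).trans (by exact_mod_cast le_max_right _ _)
  obtain ⟨ν, hν0, hνle⟩ := ht_C (m : ℝ≥0) hmt
  -- the kernel `P = P_m = P₁ᵐ`
  set Pk : Kernel (PhaseSpace N) (PhaseSpace N) := S.kernel m with hPdef
  have hPpow : Pk = S.kernel 1 ^ m := by
    rw [hPdef, ← S.kernel_nat_mul 1 m, mul_one]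
  haveI : IsMarkovKernel Pk := S.isMarkovKernel _
  have hdriftP : ∀ z, ∫⁻ y, V y ∂(Pk z) ≤ ((a ^ m : ℝ≥0) : ℝ≥0∞) * V z + B := by
    intro z
    rw [hPpow, ENNReal.coe_pow]
    exact Harris.lintegral_pow_le_of_drift (S.kernel 1) hV ha1 hdrift1 m z
  have hγ1 : a ^ m < 1 := pow_lt_one₀ zero_le ha1 hm0
  have hRcond : 2 * B < (1 - a ^ m) * R := by
    have ham : a ^ m ≤ a := pow_le_of_le_one zero_le ha1.le hm0
    calc 2 * B < 2 * B + 1 := lt_add_one _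
      _ = (1 - a) * R := hRa.symm
      _ ≤ (1 - a ^ m) * R := mul_le_mul_of_nonneg_right (tsub_le_tsub_left ham 1) zero_le
  -- the minorisation, normalised: `P(z, ·) ≥ α ν'` on `{V ≤ R}` with `ν'` a probability measure
  have hminor : ∃ (α : ℝ≥0) (ν' : Measure (PhaseSpace N)), 0 < α ∧ IsProbabilityMeasure ν' ∧
      ∀ x, V x ≤ R → α • ν' ≤ Pk x := by
    by_cases hC : ({z : PhaseSpace N | V z ≤ R}).Nonempty
    · obtain ⟨z₀, hz₀⟩ := hC
      have hνz₀ : ν ≤ Pk z₀ := hνle z₀ hz₀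
      have hνfin : ν univ ≠ ∞ :=
        ne_top_of_le_ne_top (measure_ne_top (Pk z₀) univ) (Measure.le_iff'.1 hνz₀ univ)
      haveI : IsFiniteMeasure ν := ⟨lt_top_iff_ne_top.2 hνfin⟩
      haveI : NeZero ν := ⟨hν0⟩
      have hνuniv : ν univ ≠ 0 := Measure.measure_univ_ne_zero.2 hν0
      refine ⟨(ν univ).toNNReal, (ν univ)⁻¹ • ν, ENNReal.toNNReal_pos hνuniv hνfin,
        inferInstance, fun x hx => ?_⟩
      have hsmul : (ν univ).toNNReal • ((ν univ)⁻¹ • ν) = ν := by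
        rw [ENNReal.smul_def, ENNReal.coe_toNNReal hνfin, smul_smul,
          ENNReal.mul_inv_cancel hνuniv hνfin, one_smul]
      rw [hsmul]
      exact hνle x hx
    · refine ⟨1, Measure.dirac 0, one_pos, inferInstance, fun x hx => ?_⟩
      exact absurd ⟨x, hx⟩ hC
  obtain ⟨α, ν', hα, hν', hmin⟩ := hminor
  haveI := hν'
  -- Harris' theorem for `P`
  obtain ⟨abar, b, h0, h1, hb, -, huniq, hmom⟩ :=
    Harris.harris Pk hV hγ1 hdriftP hα hRcond hmin
  refine ⟨m, abar, b, Nat.pos_of_ne_zero hm0, h0, h1, hb, huniq, fun μ hμ hinv => ?_⟩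
  obtain ⟨hle, hgeo⟩ := hmom μ hμ hinv
  refine ⟨?_, fun n φ hφm hφ x => ?_⟩
  · have : ∫⁻ z, (V z : ℝ≥0∞) ∂μ ≠ ∞ := ne_top_of_le_ne_top ENNReal.coe_ne_top hle
    simpa only [hVcoe] using this
  · have hφ' : ∀ x, |φ x| ≤ 1 + b * V x := fun x => by rw [hVreal]; exact hφ x
    have h := hgeo n φ hφm hφ' x
    simpa only [hVreal, hVcoe] using h

/-! ### The exponential convergence (2.5) -/

include hHc hcpt hCstar h34 h2 in
/-- **CEHR Theorem 2.13 (3), the exponential convergence (2.5), for the semigroup `S`, from H2,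
(3.4) and the minorisation of Prop. 3.6** (printed proof of Prop. 3.8): for
`0 < ϑ < 1/max(T_L, T_R)`, `H ≥ 0`, and an invariant probability measure `μ⋆` of `S` there are
`C, c > 0` with `|P_t f(z) - ∫ f dμ⋆| ≤ C e^{ϑH(z)} e^{-ct}` for all `z`, `t ≥ 0` and all
continuous `f` with `|f| ≤ e^{ϑH}`. Proof: Harris on the skeleton `P_{t₀}`, `t₀ = m`, gives
`|P_{nt₀} f(y) - μ⋆(f)| ≤ C₁ ᾱⁿ e^{ϑH(y)}`; for `t = n t₀ + r`, `r < t₀`, the Markov property and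
(3.4) give `|P_t f(z) - μ⋆(f)| ≤ C₁ ᾱⁿ P_r e^{ϑH}(z) ≤ C₁ e^{C_* t₀} ᾱⁿ e^{ϑH(z)}`, and
`ᾱⁿ ≤ ᾱ⁻¹ e^{-ct}` with `c = -log ᾱ / t₀`. [cite: CuneoEckmannHairerReyBellet2018, Thm 2.13 (3) and Prop 3.8] -/
theorem exp_convergence_of_H2_of_minorization (hH0 : ∀ z, 0 ≤ P.hamiltonian N z)
    (h36 : ∀ C : Set (PhaseSpace N), IsCompact C → ∃ t_C : ℝ≥0, ∀ t : ℝ≥0, t_C ≤ t →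
      ∃ ν : Measure (PhaseSpace N), ν ≠ 0 ∧ ∀ z ∈ C, ν ≤ S.kernel t z)
    {ϑ : ℝ} (hϑ0 : 0 < ϑ) (hϑ1 : ϑ < 1 / max T_L T_R)
    (μ : Measure (PhaseSpace N)) [IsProbabilityMeasure μ] (hinv : S.IsInvariant μ) :
    ∃ C c : ℝ, 0 < C ∧ 0 < c ∧
      ∀ (z : PhaseSpace N) (t : ℝ≥0) (f : PhaseSpace N → ℝ), Continuous f →
        (∀ y, |f y| ≤ Real.exp (ϑ * P.hamiltonian N y)) →
        |S.act t f z - ∫ y, f y ∂μ| ≤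
          C * Real.exp (ϑ * P.hamiltonian N z) * Real.exp (-c * t) := by
  set Hm := P.hamiltonian N with hHm
  obtain ⟨m, abar, b, hm, ha0, ha1, hb, -, hmom⟩ :=
    S.harris_of_H2_of_minorization hHc hcpt h2 h36 hϑ0 hϑ1
  obtain ⟨hμV, hgeo⟩ := hmom μ ‹_› (hinv m)
  -- notation
  set V : PhaseSpace N → ℝ≥0 := fun z => (Real.exp (ϑ * Hm z)).toNNReal with hVdef
  have hVc : Continuous V := continuous_real_toNNReal.comp (Real.continuous_exp.comp
    (continuous_const.mul hHc))
  have hV : Measurable V := hVc.measurable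
  have hVcoe : ∀ z, (V z : ℝ≥0∞) = ENNReal.ofReal (Real.exp (ϑ * Hm z)) := fun z => rfl
  have hVreal : ∀ z, (V z : ℝ) = Real.exp (ϑ * Hm z) := fun z =>
    Real.coe_toNNReal _ (Real.exp_pos _).le
  have hV1 : ∀ z, 1 ≤ Real.exp (ϑ * Hm z) := fun z => Real.one_le_exp (mul_nonneg hϑ0.le (hH0 z))
  set t₀ : ℝ≥0 := (m : ℝ≥0) with ht₀def
  have ht₀ : 0 < t₀ := by rw [ht₀def]; exact_mod_cast hm
  set Pk : Kernel (PhaseSpace N) (PhaseSpace N) := S.kernel t₀ with hPdef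
  have ht₀r : (0 : ℝ) < t₀ := by exact_mod_cast ht₀
  set mV : ℝ := (∫⁻ z, ENNReal.ofReal (Real.exp (ϑ * Hm z)) ∂μ).toReal with hmV
  have hmV0 : 0 ≤ mV := ENNReal.toReal_nonneg
  have hb0 : b ≠ 0 := hb.ne'
  set C₁ : ℝ := b⁻¹ * (2 + b * mV) + 1 with hC₁def
  have hC₁ : 0 < C₁ := by rw [hC₁def]; positivity
  have hCs : 0 ≤ Cstar ϑ := hCstar ϑ hϑ0
  set c : ℝ := -Real.log abar / t₀ with hcdef
  have hlog : Real.log abar < 0 := Real.log_neg ha0 ha1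
  have hc : 0 < c := by rw [hcdef]; exact div_pos (by linarith) ht₀r
  refine ⟨C₁ * Real.exp (Cstar ϑ * t₀) / abar, c, by positivity, hc, fun z t f hf hfV => ?_⟩
  -- finiteness of the `V`-moments along the semigroup, (3.4)
  have h34s : ∀ (s : ℝ≥0) (x : PhaseSpace N), ∫⁻ y, (V y : ℝ≥0∞) ∂(S.kernel s x) ≤
      ENNReal.ofReal (Real.exp (Cstar ϑ * s) * Real.exp (ϑ * Hm x)) := fun s x =>
    h34 ϑ hϑ0 hϑ1 s x
  have h34' : ∀ (s : ℝ≥0) (x : PhaseSpace N), ∫⁻ y, (V y : ℝ≥0∞) ∂(S.kernel s x) ≠ ∞ :=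
    fun s x => ne_top_of_le_ne_top ENNReal.ofReal_ne_top (h34s s x)
  have hfm : Measurable f := hf.measurable
  have hfV' : ∀ y, |f y| ≤ 0 + 1 * V y := fun y => by rw [hVreal, zero_add, one_mul]; exact hfV y
  have hfint : ∀ (s : ℝ≥0) (x : PhaseSpace N), Integrable f (S.kernel s x) := fun s x =>
    Harris.integrable_of_abs_le_affine hV (h34' s x) hfm hfV'
  -- Harris on the skeleton: `|Pⁿ f(x) - μ(f)| ≤ ᾱⁿ C₁ e^{ϑH(x)}`
  have hskel : ∀ (n : ℕ) (x : PhaseSpace N),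
      |∫ y, f y ∂((Pk ^ n) x) - ∫ y, f y ∂μ| ≤ abar ^ n * C₁ * Real.exp (ϑ * Hm x) := by
    intro n x
    have hφm : Measurable fun y => b * f y := hfm.const_mul b
    have hφ : ∀ y, |b * f y| ≤ 1 + b * Real.exp (ϑ * Hm y) := fun y => by
      rw [abs_mul, abs_of_pos hb]
      have := mul_le_mul_of_nonneg_left (hfV y) hb.le
      linarith
    have h := hgeo n (fun y => b * f y) hφm hφ x
    rw [integral_const_mul, integral_const_mul, ← mul_sub, abs_mul, abs_of_pos hb] at h
    have h' : |∫ y, f y ∂((Pk ^ n) x) - ∫ y, f y ∂μ| ≤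
        abar ^ n * (b⁻¹ * (2 + b * mV) + Real.exp (ϑ * Hm x)) := by
      have h1 := mul_le_mul_of_nonneg_left h (inv_nonneg.2 hb.le)
      rw [inv_mul_cancel_left₀ hb0] at h1
      refine h1.trans (le_of_eq ?_)
      field_simp
      ring
    refine h'.trans ?_
    rw [mul_assoc]
    refine mul_le_mul_of_nonneg_left ?_ (pow_nonneg ha0.le n)
    have hE := hV1 x
    have hpos : 0 ≤ b⁻¹ * (2 + b * mV) := by positivity
    rw [hC₁def]
    nlinarith [mul_nonneg hpos (sub_nonneg.2 hE)]
  -- `t = r + n t₀`, `r < t₀`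
  obtain ⟨n, r, hr, rfl⟩ := exists_eq_add_nat_mul_of_pos ht₀ t
  -- the Markov property: `P_t f(z) = ∫ Pⁿ f(y) P_r(z, dy)`
  set g : PhaseSpace N → ℝ := fun y => ∫ w, f w ∂((Pk ^ n) y) with hg
  have hgm : Measurable g := (hfm.stronglyMeasurable.integral_kernel (κ := Pk ^ n)).measurable
  have hact : S.act (r + n * t₀) f z = ∫ y, g y ∂(S.kernel r z) := by
    have hint : Integrable f (((Pk ^ n) ∘ₖ S.kernel r) z) := by
      have := hfint (r + n * t₀) z
      rwa [S.kernel_add, S.kernel_nat_mul] at this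
    rw [LangevinChainSemigroup.act_apply, S.kernel_add, S.kernel_nat_mul, ← hPdef]
    rw [Kernel.comp_apply] at hint ⊢
    exact Harris.integral_comp_measure (Pk ^ n) (S.kernel r z) hint
  rw [hact]
  -- integrate the skeleton bound against `P_r(z, ·)`
  have hgb : ∀ y, |g y - ∫ w, f w ∂μ| ≤ abar ^ n * C₁ * Real.exp (ϑ * Hm y) := fun y => hskel n y
  have hgi : Integrable g (S.kernel r z) := by
    refine Harris.integrable_of_abs_le_affine hV (h34' r z) hgm (A := |∫ w, f w ∂μ|)
      (B := abar ^ n * C₁) fun y => ?_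
    have h1 := hgb y
    rw [hVreal]
    have h2 : |g y| ≤ |∫ w, f w ∂μ| + |g y - ∫ w, f w ∂μ| := by
      have := abs_add_le (∫ w, f w ∂μ) (g y - ∫ w, f w ∂μ); rwa [add_sub_cancel] at this
    linarith
  have hVi : Integrable (fun y => (V y : ℝ)) (S.kernel r z) :=
    Harris.integrable_coe_of_lintegral_ne_top hV (h34' r z)
  have hsub : (∫ y, g y ∂(S.kernel r z)) - ∫ w, f w ∂μ =
      ∫ y, (g y - ∫ w, f w ∂μ) ∂(S.kernel r z) := by
    rw [integral_sub hgi (integrable_const _), integral_const, probReal_univ, one_smul]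
  have hPr : (∫⁻ y, (V y : ℝ≥0∞) ∂(S.kernel r z)).toReal ≤
      Real.exp (Cstar ϑ * t₀) * Real.exp (ϑ * Hm z) := by
    refine (ENNReal.toReal_le_of_le_ofReal (by positivity) (h34s r z)).trans ?_
    refine mul_le_mul_of_nonneg_right (Real.exp_le_exp.2 ?_) (Real.exp_pos _).le
    exact mul_le_mul_of_nonneg_left (by exact_mod_cast hr.le) hCs
  -- `ᾱⁿ ≤ ᾱ⁻¹ e^{-ct}`
  have hpow : abar ^ n ≤ abar⁻¹ * Real.exp (-c * ((r + n * t₀ : ℝ≥0) : ℝ)) := by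
    have hlogeq : Real.log abar = -c * t₀ := by
      rw [hcdef, neg_mul, div_mul_cancel₀ _ ht₀r.ne', neg_neg]
    have hn : abar ^ n = Real.exp (n * Real.log abar) := by
      rw [Real.exp_nat_mul, Real.exp_log ha0]
    have hinv' : abar⁻¹ = Real.exp (c * t₀) := by
      have : Real.exp (c * t₀) = Real.exp (-Real.log abar) := by
        rw [hlogeq]; simp only [neg_mul, neg_neg]
      rw [this, Real.exp_neg, Real.exp_log ha0]
    rw [hn, hinv', ← Real.exp_add]
    refine Real.exp_le_exp.2 ?_
    rw [hlogeq]
    push_cast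
    have hr' : ((r : ℝ≥0) : ℝ) ≤ t₀ := by exact_mod_cast hr.le
    have hc0 : 0 ≤ c := hc.le
    nlinarith [mul_nonneg hc0 (sub_nonneg.2 hr')]
  calc |(∫ y, g y ∂(S.kernel r z)) - ∫ w, f w ∂μ|
      = |∫ y, (g y - ∫ w, f w ∂μ) ∂(S.kernel r z)| := by rw [hsub]
    _ ≤ ∫ y, |g y - ∫ w, f w ∂μ| ∂(S.kernel r z) := abs_integral_le_integral_abs
    _ ≤ ∫ y, abar ^ n * C₁ * (V y : ℝ) ∂(S.kernel r z) := by
        refine integral_mono (hgi.sub (integrable_const _)).abs (hVi.const_mul _) fun y => ?_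
        have := hgb y
        rwa [← hVreal] at this
    _ = abar ^ n * C₁ * (∫⁻ y, (V y : ℝ≥0∞) ∂(S.kernel r z)).toReal := by
        rw [integral_const_mul, Harris.integral_coe_eq_toReal hV]
    _ ≤ abar ^ n * C₁ * (Real.exp (Cstar ϑ * t₀) * Real.exp (ϑ * Hm z)) :=
        mul_le_mul_of_nonneg_left hPr (by positivity)
    _ ≤ (abar⁻¹ * Real.exp (-c * ((r + n * t₀ : ℝ≥0) : ℝ))) * C₁ *
          (Real.exp (Cstar ϑ * t₀) * Real.exp (ϑ * Hm z)) := by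
        gcongr
    _ = C₁ * Real.exp (Cstar ϑ * t₀) / abar * Real.exp (ϑ * Hm z) *
          Real.exp (-c * ((r + n * t₀ : ℝ≥0) : ℝ)) := by
        ring

include hHc hcpt h2 in
/-- **CEHR Theorem 2.13 (1), uniqueness, for the semigroup `S`**: under H2 and the minorisation of
Prop. 3.6 for the kernels of `S`, `S` has at most one invariant probability measure (any two are
invariant for the skeleton `P_m` of `harris_of_H2_of_minorization`).
[cite: CuneoEckmannHairerReyBellet2018, Thm 2.13 (1) and Prop 3.8] -/
theorem invariant_unique_of_H2_of_minorization (hTm' : 0 < 1 / max T_L T_R)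
    (h36 : ∀ C : Set (PhaseSpace N), IsCompact C → ∃ t_C : ℝ≥0, ∀ t : ℝ≥0, t_C ≤ t →
      ∃ ν : Measure (PhaseSpace N), ν ≠ 0 ∧ ∀ z ∈ C, ν ≤ S.kernel t z)
    (μ ν : Measure (PhaseSpace N)) [IsProbabilityMeasure μ] [IsProbabilityMeasure ν]
    (hμ : S.IsInvariant μ) (hν : S.IsInvariant ν) : μ = ν := by
  obtain ⟨m, abar, b, -, -, -, -, huniq, -⟩ := S.harris_of_H2_of_minorization hHc hcpt h2 h36
    (ϑ := 1 / max T_L T_R / 2) (by positivity) (half_lt_self hTm')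
  exact huniq μ ν ‹_› ‹_› (hμ _) (hν _)

end LangevinChainSemigroup

end Literature.MathematicalPhysics.KineticTheory.HeatConduction

end
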